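import Mathlib
import Summits.CriticalPhenomena.PercolationContinuityZ3.Theorems.PercNearOneGluingNoHeavyLowerTailAntipodalStrongHarris

/-!
# Section decomposition: the Ahlswede–Daykin split for goods above a family, and SD-certificates

Helper file for crux `stmt-CriticalPhenomena-4575` (`NoHeavyLowerTail`, route `PercNearOneGluingNoHeavy`), hull-port seat
`prim-hp-7` (generation 54); `--supports stmt-CriticalPhenomena-4575`.  Everything here is PROVED; no definitions (the recursive
certificate format `SDCert` built on this file lives in `…OrientedAntipodalHallSDCert`).

Setting (memo `prim-hp-7/FROM-prim-hp-7-g54-THREE-PETALS.md` §8).  Work with a PAIR of labellings `g h : Finset α → Lab k`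
(no monotonicity is needed for the counting): the *goods* of the pair on a ground set `S` are the `U ⊆ S` with `g U = A` and
`h (S \ U) = B`; for the single labelling of the IC/CoI-Kleitman problem take `g = h = f`.  For a family `D` of subsets of `S`
and `e ∈ S`, the goods above `D` that contain `e` correspond to the goods above the PROJECTED family `{X \ e}` for the section
pair `(g (insert e ·), h)` on `S \ e`, and the `e`-free goods above the DOUBLETONS `{X ∈ D : e ∉ X, insert e X ∈ D}` are goods for
the pair `(g, h (insert e ·))` on `S \ e`; since `#D = #{X \ e} + #doubletons` (the Ahlswede–Daykin count), the Hall count for `D`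
follows from the Hall counts of the two section families (`card_filter_goods_ge_sections`; the count
`card_eq_card_doubletons_add_card_image_erase`).  Iterating the split gives the SD-certificates of `…OrientedAntipodalHallSDCert`;
empirically (memo §8): the doubleton inequality (II) held for EVERY e in 6.3·10⁶ (family, e) pairs, and some e satisfies both
section inequalities in all 1.1·10⁶ co-intersecting families tested.  (prim-hp-7 gen 54, 2026-08-22.)
-/

namespace Summit.CriticalPhenomena.PercolationContinuityZ3.Theorems

namespace OrientedAntipodalHall

open Finset AntipodalStrongHarris AntipodalStrongHarris.Lab
open scoped FinsetFamily

variable {α : Type*} [DecidableEq α] {k : ℕ}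

/-- The Ahlswede–Daykin sectioning count: `#D = #{X ∈ D : e ∉ X, insert e X ∈ D} + #{X \ e : X ∈ D}` (the fibres of
`X ↦ X.erase e` have one or two elements, two exactly over the doubletons). [cite: AhlswedeDaykin1979, Theorem 37 (proof)] -/
theorem card_eq_card_doubletons_add_card_image_erase (D : Finset (Finset α)) (e : α) :
    #D = #(D.filter fun X => e ∉ X ∧ insert e X ∈ D) + #(D.image fun X => X.erase e) := by
  set D₀ := D.filter fun X => e ∉ X with hD₀
  set Dp := D.filter fun X => e ∈ X with hDp
  have hsplit : #D = #Dp + #D₀ := (card_filter_add_card_filter_not (fun X => e ∈ X)).symm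
  have himg : D.image (fun X => X.erase e) = D₀ ∪ Dp.image fun X => X.erase e := by
    ext E
    simp only [mem_image, mem_union, hD₀, hDp, mem_filter]
    constructor
    · rintro ⟨X, hX, rfl⟩
      by_cases he : e ∈ X
      · exact Or.inr ⟨X, ⟨hX, he⟩, rfl⟩
      · exact Or.inl ⟨by rwa [erase_eq_of_notMem he], notMem_erase e X⟩
    · rintro (⟨hE, heE⟩ | ⟨X, ⟨hX, -⟩, rfl⟩)
      · exact ⟨E, hE, erase_eq_of_notMem heE⟩
      · exact ⟨X, hX, rfl⟩
  have hinj : Set.InjOn (fun X => X.erase e) (Dp : Set (Finset α)) := by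
    intro X hX X' hX' hXX
    have heX : e ∈ X := (mem_filter.1 hX).2
    have heX' : e ∈ X' := (mem_filter.1 hX').2
    have h' : X.erase e = X'.erase e := hXX
    rw [← insert_erase heX, h', insert_erase heX']
  have hcardp : #(Dp.image fun X => X.erase e) = #Dp := card_image_of_injOn hinj
  have hinter : D₀ ∩ Dp.image (fun X => X.erase e) = D.filter fun X => e ∉ X ∧ insert e X ∈ D := by
    ext E
    simp only [mem_inter, mem_image, hD₀, hDp, mem_filter]
    constructor
    · rintro ⟨⟨hE, heE⟩, X, ⟨hX, heX⟩, hXE⟩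
      refine ⟨hE, heE, ?_⟩
      rwa [← hXE, insert_erase heX]
    · rintro ⟨hE, heE, hins⟩
      exact ⟨⟨hE, heE⟩, insert e E, ⟨hins, mem_insert_self e E⟩, erase_insert heE⟩
  rw [himg, ← hinter, hsplit, ← hcardp]
  have := card_union_add_card_inter D₀ (Dp.image fun X => X.erase e)
  omega

/-- **Section decomposition of the goods above a family.**  For a pair of labellings `g, h`, a ground set `S ∋ e` and a family
`D` of subsets of `S`: the goods `U ⊆ S` (`g U = A`, `h (S \ U) = B`) lying above a member of `D` are at least as many as the goods
of the section pair `(g (insert e ·), h)` on `S \ e` above the projected family `{X \ e}` PLUS the goods of the section pair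
`(g, h (insert e ·))` on `S \ e` above the doubletons `{X ∈ D : e ∉ X, insert e X ∈ D}`. -/
theorem card_filter_goods_ge_sections (S : Finset α) {e : α} (he : e ∈ S) (g h : Finset α → Lab k)
    (D : Finset (Finset α)) :
    #{U' ∈ (S.erase e).powerset | g (insert e U') = top ∧ h ((S.erase e) \ U') = bot ∧
        ∃ Y ∈ D.image (fun X : Finset α => X.erase e), Y ⊆ U'} +
      #{U' ∈ (S.erase e).powerset | g U' = top ∧ h (insert e ((S.erase e) \ U')) = bot ∧
        ∃ X ∈ D.filter (fun X : Finset α => e ∉ X ∧ insert e X ∈ D), X ⊆ U'} ≤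
      #{U ∈ S.powerset | g U = top ∧ h (S \ U) = bot ∧ ∃ X ∈ D, X ⊆ U} := by
  set G : Finset (Finset α) := {U ∈ S.powerset | g U = top ∧ h (S \ U) = bot ∧ ∃ X ∈ D, X ⊆ U} with hG
  set G₁ := G.filter fun U => e ∈ U with hG₁
  set G₀ := G.filter fun U => e ∉ U with hG₀
  have hsplit : #G = #G₁ + #G₀ := (card_filter_add_card_filter_not (fun U => e ∈ U)).symm
  -- level one: `U' ↦ insert e U'` lands in `G₁`, injectively
  have h1 : #{U' ∈ (S.erase e).powerset | g (insert e U') = top ∧ h ((S.erase e) \ U') = bot ∧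
      ∃ Y ∈ D.image (fun X : Finset α => X.erase e), Y ⊆ U'} ≤ #G₁ := by
    refine Finset.card_le_card_of_injOn (fun U' => insert e U') (fun U' hU' => ?_) (fun U' hU' V' hV' hUV => ?_)
    · simp only [Finset.mem_coe] at hU' ⊢
      rw [mem_filter, mem_powerset] at hU'
      obtain ⟨hU'S, hgt, hhb, Y, hY, hYU⟩ := hU'
      obtain ⟨X, hX, rfl⟩ := mem_image.1 hY
      have hSU : S \ insert e U' = (S.erase e) \ U' := by
        ext x
        simp only [mem_sdiff, mem_insert, mem_erase, not_or]
        tauto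
      rw [hG₁, mem_filter, hG, mem_filter, mem_powerset]
      refine ⟨⟨?_, hgt, by rw [hSU]; exact hhb, X, hX, ?_⟩, mem_insert_self e U'⟩
      · exact insert_subset he (hU'S.trans (erase_subset e S))
      · intro x hx
        by_cases hxe : x = e
        · rw [hxe]; exact mem_insert_self e U'
        · exact mem_insert_of_mem (hYU (mem_erase.2 ⟨hxe, hx⟩))
    · simp only [Finset.mem_coe] at hU' hV'
      have heU' : e ∉ U' := fun h' => (notMem_erase e S) ((mem_powerset.1 (mem_filter.1 hU').1) h')
      have heV' : e ∉ V' := fun h' => (notMem_erase e S) ((mem_powerset.1 (mem_filter.1 hV').1) h')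
      have := congrArg (fun U => Finset.erase U e) hUV
      simpa only [erase_insert heU', erase_insert heV'] using this
  -- level zero: the `e`-free goods above the doubletons are in `G₀`
  have h0 : #{U' ∈ (S.erase e).powerset | g U' = top ∧ h (insert e ((S.erase e) \ U')) = bot ∧
      ∃ X ∈ D.filter (fun X : Finset α => e ∉ X ∧ insert e X ∈ D), X ⊆ U'} ≤ #G₀ := by
    refine card_le_card fun U' hU' => ?_
    rw [mem_filter, mem_powerset] at hU'
    obtain ⟨hU'S, hgt, hhb, X, hX, hXU⟩ := hU'
    have heU' : e ∉ U' := fun h' => (notMem_erase e S) (hU'S h')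
    have hSU : S \ U' = insert e ((S.erase e) \ U') := by
      ext x
      simp only [mem_sdiff, mem_insert, mem_erase]
      constructor
      · rintro ⟨hxS, hxU⟩
        by_cases hxe : x = e
        · exact Or.inl hxe
        · exact Or.inr ⟨⟨hxe, hxS⟩, hxU⟩
      · rintro (hxe | ⟨⟨-, hxS⟩, hxU⟩)
        · subst hxe; exact ⟨he, heU'⟩
        · exact ⟨hxS, hxU⟩
    rw [hG₀, mem_filter, hG, mem_filter, mem_powerset]
    exact ⟨⟨hU'S.trans (erase_subset e S), hgt, by rw [hSU]; exact hhb, X, (mem_filter.1 hX).1, hXU⟩, heU'⟩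
  rw [hsplit]
  omega

end OrientedAntipodalHall

end Summit.CriticalPhenomena.PercolationContinuityZ3.Theorems
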